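import Mathlib
import Literature.Claims.NS.Bledsoe2026
import HarnessLib

/-!
# Solo salvage for claim C86 `Bledsoe2026` (cell `ns-claims`, D-0090): the §5.4 closing step is TRUE

Claim: B. Bledsoe, «A Constructive Proof of Global Existence and Smoothness for the 3D Navier–Stokes
Equations» (Zenodo 17116634, NS_v2_6.pdf, 2025; row C86, lineage text of record; skeleton p487907,
typist-8 g2; salvage lane salvage-p4 g2). The adjudication target is §4.4 p.7 (the cubic stretching bound
(3), `Step_44_cubicStretchingBound` / `Step_44_naiveHoelder`). Independently of it, §5.4 p.10 l.26–37
prints the closing step «compressed balance `φ' ≤ 3(1 − δ)κ₃ φ` ⇒ `φ = ‖ω‖³_{L³}` bounded on finite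
horizons», typed as `Literature.Claims.NS.Bledsoe2026.Step_54_closing`. This file records its exact
status in the kernel:

* `le_mul_exp_of_deriv_le` — the honest content of §5.4 at the Grönwall grain: `φ` differentiable on
  `[0,T]` with `φ' ≤ a·φ` on `(0,T)` satisfies `φ(t) ≤ φ(0)·e^{a t}` on `[0,T]` (monotonicity of
  `φ·e^{−a·}`, Mathlib `antitoneOn_of_deriv_nonpos`; no sign assumption on `a` or `φ`);
* `step_54_closing_holds : Step_54_closing` — the typed step, discharged through that bound with
  `M = φ(0)·e^{|a|T}`, `a = 3(1 − δ)κ` (it is also true for the softer reason that a function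
  differentiable on the compact `[0,T]` is bounded there, `exists_bound_of_differentiableOn_Icc`).

So the printed chain's content sits entirely in the a-priori input `Step_23_vorticityL3` (delivered in
print by (3)/(4)) and the continuation `Step_BKM`; the closing inference itself is classical Grönwall.

WHAT THIS IS NOT: not a claim about NS regularity or blow-up; not a claim about any author beyond the typed locator.
-/

set_option linter.dupNamespace false

noncomputable section

namespace Summit.NavierStokesRegularity.NavierStokesRegularity.Theorems.Bledsoe2026

open Set Real

/-! ## Grönwall at the grain of §5.4 -/

/-- **Grönwall, one-sided, finite horizon.** If `φ` is differentiable on `[0,T]` and `φ' ≤ a φ` on the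
open interval `(0,T)`, then `φ(t) ≤ φ(0) e^{a t}` for `t ∈ [0,T]`: the function `s ↦ φ(s)e^{−as}` has
non-positive derivative on `(0,T)` and is continuous on `[0,T]`, hence antitone there.
[cite: Bledsoe2026, §5.4 p.10 l.26–37 («by Grönwall»)] -/
theorem le_mul_exp_of_deriv_le {φ : ℝ → ℝ} {a T : ℝ} (hdiff : DifferentiableOn ℝ φ (Icc 0 T))
    (hderiv : ∀ t ∈ Ioo 0 T, deriv φ t ≤ a * φ t) :
    ∀ t ∈ Icc 0 T, φ t ≤ φ 0 * exp (a * t) := by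
  intro t ht
  set ψ : ℝ → ℝ := fun s => φ s * exp (-(a * s)) with hψ
  have hcont : ContinuousOn ψ (Icc 0 T) := hdiff.continuousOn.mul (by fun_prop)
  have hat : ∀ s ∈ Ioo 0 T, DifferentiableAt ℝ φ s := fun s hs =>
    (hdiff s (Ioo_subset_Icc_self hs)).differentiableAt (Icc_mem_nhds hs.1 hs.2)
  have hexpd : ∀ s : ℝ, HasDerivAt (fun x => exp (-(a * x))) (exp (-(a * s)) * (-a)) s := by
    intro s
    have h := (((hasDerivAt_id s).const_mul a).neg).exp
    simpa using h
  have hdiffψ : DifferentiableOn ℝ ψ (interior (Icc 0 T)) := by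
    rw [interior_Icc]
    intro s hs
    exact ((hat s hs).mul (hexpd s).differentiableAt).differentiableWithinAt
  have hderivψ : ∀ s ∈ interior (Icc 0 T), deriv ψ s ≤ 0 := by
    rw [interior_Icc]
    intro s hs
    have h2 : HasDerivAt ψ (deriv φ s * exp (-(a * s)) + φ s * (exp (-(a * s)) * (-a))) s :=
      (hat s hs).hasDerivAt.mul (hexpd s)
    rw [h2.deriv]
    have hpos : 0 < exp (-(a * s)) := exp_pos _
    nlinarith [hderiv s hs, hpos]
  have hanti := antitoneOn_of_deriv_nonpos (convex_Icc 0 T) hcont hdiffψ hderivψ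
  have h0 : (0 : ℝ) ∈ Icc 0 T := ⟨le_rfl, ht.1.trans ht.2⟩
  have hle : ψ t ≤ ψ 0 := hanti h0 ht ht.1
  have hψt : ψ t = φ t * exp (-(a * t)) := rfl
  have hψ0 : ψ 0 = φ 0 := by simp [hψ]
  rw [hψt, hψ0] at hle
  have hexp : 0 < exp (a * t) := exp_pos _
  calc φ t = φ t * exp (-(a * t)) * exp (a * t) := by
        rw [mul_assoc, ← exp_add]; simp
    _ ≤ φ 0 * exp (a * t) := by gcongr

/-- A function differentiable on the compact interval `[0,T]` is bounded above there (continuity on a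
compact set) — the soft reason `Step_54_closing` holds, independent of any differential inequality.
[cite: Bledsoe2026, §5.4 p.10 l.26–37] -/
theorem exists_bound_of_differentiableOn_Icc {φ : ℝ → ℝ} {T : ℝ}
    (hdiff : DifferentiableOn ℝ φ (Icc 0 T)) : ∃ M : ℝ, ∀ t ∈ Icc 0 T, φ t ≤ M := by
  obtain ⟨M, hM⟩ := isCompact_Icc.bddAbove_image hdiff.continuousOn
  exact ⟨M, fun t ht => hM ⟨t, ht, rfl⟩⟩

/-- **C86 salvage: `Step_54_closing` (§5.4 p.10 at the Grönwall grain) is TRUE.** Every non-negative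
`φ` differentiable on `[0,T]` with `φ' ≤ 3(1 − δ)κ·φ` on `[0,T)` is bounded on `[0,T]`, explicitly by
`φ(0)·exp(|3(1 − δ)κ|·T)` (`le_mul_exp_of_deriv_le`). No sign condition on `δ` or `κ` is needed, so the
step carries no Navier–Stokes content: the printed chain's load sits in `Step_23_vorticityL3` / (3).
[cite: Bledsoe2026, §5.4 p.10 l.26–37; Thm 2.3 p.3] -/
theorem step_54_closing_holds : Literature.Claims.NS.Bledsoe2026.Step_54_closing := by
  intro δ κ T φ hT hφ hdiff hderiv
  set a : ℝ := 3 * (1 - δ) * κ with ha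
  refine ⟨φ 0 * exp (|a| * T), fun t ht => ?_⟩
  have h1 : φ t ≤ φ 0 * exp (a * t) :=
    le_mul_exp_of_deriv_le hdiff (fun s hs => by simpa [ha] using hderiv s (Ioo_subset_Ico_self hs)) t ht
  have h2 : a * t ≤ |a| * T := by
    calc a * t ≤ |a| * t := mul_le_mul_of_nonneg_right (le_abs_self a) ht.1
      _ ≤ |a| * T := mul_le_mul_of_nonneg_left ht.2 (abs_nonneg a)
  calc φ t ≤ φ 0 * exp (a * t) := h1
    _ ≤ φ 0 * exp (|a| * T) := by gcongr; exact hφ 0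

end Summit.NavierStokesRegularity.NavierStokesRegularity.Theorems.Bledsoe2026

end
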